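import Summits.Ventures.HSemireg.ObstructionLocusArrangement

/-!
# Venture HSemireg — (S5) OBSTRUCTION LOCUS away from secant type, VI: the class-contraction map `κ_Z = ⌟[Z]` on
# `H¹(T_X)` — one coordinate sub-torus, and the bookkeeping of a NEAR PAIR through the same source space

HONEST FRAMING.  Sequel of `ObstructionLocusTorus.lean` / `ObstructionLocusArrangement.lean` (cell `pub-hsemireg`, track
«S4-PUSH» (ii), seat s4-prove-2); with its companion `ObstructionLocusNCUnion.lean` it types and PROVES, as finite linear
algebra over an arbitrary field and for every `N`, the last closed form of STRUCTURE.md §1.1 C7(d) / §2 (S-B) «UNIFORM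
LEMMA FORM (INJ n², n² + 2n − 2; pair KER 1)» that files III/III′ left cited: the normal-crossings 2-union.  Nothing here
constructs a variety, a normal sheaf or Bloch's semiregularity map `π`; nothing here says that HC / HC_CM / HC_AV holds; no
Literature fact is declared or used.  As for all of REGIME A, these rows are CLASS-DEAD (torus-stable classes are sums of
diagonal monomials; the Weil / secant component is isotropic): they say where NOT to look and calibrate the engines.

THE MODEL (G2-DEFORM-SANITY.md §B.4, §C.1; WEIGHT-TABLES.md rows CTRL1-n*-03 «nc 2-union»).  `H¹(T_X)`, `X = E^N`, has
basis `θ_q = dz̄_{q.1} ⊗ ∂_{q.2}` (`q : Fin N × Fin N`); `[B_S] ∼ dz_S ∧ dz̄_S` for the coordinate sub-torus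
`B_S = {x_k = const : k ∈ S}`; hence `θ_q ⌟ [B_S] = ± dz_{S ∖ q.2} ∧ dz̄_{S ∪ q.1}` if `q.1 ∉ S ∧ q.2 ∈ S`
(`q ∈ act S = Sᶜ ×ˢ S`, target monomial `tg S q` = the `blochTarget` of file III) and `0` otherwise.  For `Z = B_S ∪ B_{S'}`
(ANY union — `κ_Z` only sees the class `[Z] = [B_S] + [B_{S'}]`) the contraction map `κ_Z : ξ ↦ ξ ⌟ [Z]` on `H¹(T_X)` is
`kappa S ε + kappa S' ε'`, typed with ARBITRARY non-zero coefficients `ε, ε'` on the active sources (sign- and scale-free: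
no sign and no normalisation of `[B_S]` is ever evaluated).

PROVED HERE (kernel, every `N`, all non-zero signs):
* `kappa_single`, `range_kappa`, `finrank_range_kappa` — one sub-torus: `rank κ_{B_S} = (N − |S|)·|S|` (`= n²` at
  `|S| = n`, `N = 2n`) `= h¹(N_{B_S})` (`card_blochIndex`, file III): the `κ`-model form of «single torus INJ n²»
  («`r` onto and `π` injective», see `single_inj` in the companion file).
* near-pair bookkeeping (`S ∖ k = S' ∖ k'`, `S ≠ S'`): `near_union_inter` (`S ∪ S' = S + k'`, `S ∩ S' = S − k`,
  `|S'| = |S|`); `card_act_inter_act` — the DOUBLY active sources (`q.1 ∉ S ∪ S'`, `q.2 ∈ S ∩ S'`) number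
  `(N − p − 1)(p − 1)`; `image_sdiff_inter_image_sdiff` — the singly active sources of the two types share EXACTLY ONE
  monomial (file III's «pair KER 1» coincidence `dz_{S∖k} ∧ dz̄_{S ∪ k'}`); `tg_ne_tg_of_both`, `tg_not_mem_of_both` —
  doubly active sources hit PRIVATE monomials; `ncFamily`, `linearIndependent_ncFamily` — the resulting candidate basis of
  `range κ_Z` is linearly independent; `kappa_pair_single`.
References (dictionary only): Bloch 1972 §4, §6; cell files G2-DEFORM-SANITY.md §B.4/§C.1/§D, WEIGHT-TABLES.md (CTRL1
rows, C7(d)), STRUCTURE.md §1.1 C7(d), §2 (S-B)/(S5).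
-/

open scoped BigOperators
open Finset

namespace Summit.Ventures.HSemireg.ObstructionLocus

variable {K : Type*} [Field K]

/-! ## The contraction map `κ` of one coordinate sub-torus class -/

section Kappa

variable {N : ℕ}

/-- Index of the target monomials `dz_A ∧ dz̄_B` of `⊕ H^{a,b}(E^N)`. -/
abbrev Mono (N : ℕ) : Type := Finset (Fin N) × Finset (Fin N)

/-- The sources `θ_q = dz̄_{q.1} ⊗ ∂_{q.2}` of `H¹(T_X)` that contract non-trivially against `[B_S] ∼ dz_S ∧ dz̄_S`:
`q.1 ∉ S` and `q.2 ∈ S` (the index set `BlochIndex S` of file III, as a Finset). -/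
def act (S : Finset (Fin N)) : Finset (Fin N × Fin N) := Sᶜ ×ˢ S

/-- Membership in `act S`. -/
theorem mem_act {S : Finset (Fin N)} {q : Fin N × Fin N} : q ∈ act S ↔ q.1 ∉ S ∧ q.2 ∈ S := by
  simp [act, Finset.mem_product]

/-- `|act S| = (N − |S|)·|S|` (`= h¹(N_{B_S})`, `card_blochIndex`). -/
theorem card_act (S : Finset (Fin N)) : (act S).card = (N - S.card) * S.card := by
  rw [act, Finset.card_product, Finset.card_compl, Fintype.card_fin]

/-- The target monomial `dz_{S ∖ q.2} ∧ dz̄_{S ∪ q.1}` of `θ_q ⌟ [B_S]` (`= blochTarget S ⟨q, _⟩` of file III). -/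
def tg (S : Finset (Fin N)) (q : Fin N × Fin N) : Mono N := (S.erase q.2, insert q.1 S)

/-- `tg` is file III's `blochTarget` on active sources. -/
theorem blochTarget_eq_tg (S : Finset (Fin N)) (p : BlochIndex S) : blochTarget S p = tg S p.1 := rfl

/-- Active sources of one type hit pairwise distinct monomials (file III `blochTarget_injective`). -/
theorem tg_injOn (S : Finset (Fin N)) : Set.InjOn (tg S) (act S : Set (Fin N × Fin N)) := by
  intro q hq q' hq' h
  have hq1 := mem_act.1 (Finset.mem_coe.1 hq)
  have hq2 := mem_act.1 (Finset.mem_coe.1 hq')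
  have := blochTarget_injective S (a₁ := ⟨q, hq1⟩) (a₂ := ⟨q', hq2⟩) h
  exact congrArg Subtype.val this

/-- **`κ_{B_S}`**: the contraction map `ξ ↦ ξ ⌟ [B_S]` on `H¹(T_X)` in the basis `θ_q`, with arbitrary coefficients
`ε q` on the active sources (Bloch's are `± 1`; nothing below evaluates them). -/
def kappa (S : Finset (Fin N)) (ε : Fin N × Fin N → K) : (Fin N × Fin N → K) →ₗ[K] (Mono N → K) where
  toFun v m := ∑ q ∈ (act S).filter (fun q => tg S q = m), ε q * v q
  map_add' v w := by
    funext m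
    simp only [Pi.add_apply, mul_add, Finset.sum_add_distrib]
  map_smul' c v := by
    funext m
    simp only [Pi.smul_apply, smul_eq_mul, RingHom.id_apply, Finset.mul_sum]
    refine Finset.sum_congr rfl fun q _ => by ring

/-- Components of `κ`. -/
theorem kappa_apply (S : Finset (Fin N)) (ε : Fin N × Fin N → K) (v : Fin N × Fin N → K) (m : Mono N) :
    kappa S ε v m = ∑ q ∈ (act S).filter (fun q => tg S q = m), ε q * v q := rfl

/-- `κ` on a basis vector: `θ_q ↦ ε_q • e_{tg S q}` if `q` is active, `0` otherwise. -/
theorem kappa_single (S : Finset (Fin N)) (ε : Fin N × Fin N → K) (q₀ : Fin N × Fin N) (c : K) :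
    kappa S ε (Pi.single q₀ c)
      = if q₀ ∈ act S then Pi.single (M := fun _ => K) (tg S q₀) (ε q₀ * c) else 0 := by
  by_cases hq : q₀ ∈ act S
  · rw [if_pos hq]
    funext m
    rw [kappa_apply]
    by_cases hm : tg S q₀ = m
    · rw [Finset.sum_eq_single q₀]
      · subst hm; simp
      · intro q _ hne; simp [hne]
      · intro h; exact absurd (Finset.mem_filter.2 ⟨hq, hm⟩) h
    · rw [Finset.sum_eq_zero]
      · simp [hm]
      · intro q hq'
        have : q ≠ q₀ := by rintro rfl; exact hm (Finset.mem_filter.1 hq').2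
        simp [this]
  · rw [if_neg hq]
    funext m
    rw [kappa_apply, Pi.zero_apply, Finset.sum_eq_zero]
    intro q hq'
    have : q ≠ q₀ := by rintro rfl; exact hq (Finset.mem_filter.1 hq').1
    simp [this]

/-- A basis vector with a scalar is the scalar multiple of the unit basis vector. -/
theorem single_eq_smul_single_one (m : Mono N) (a : K) :
    Pi.single (M := fun _ => K) m a = a • Pi.single (M := fun _ => K) m 1 := by
  funext m'
  by_cases h : m' = m
  · subst h; simp
  · simp [h]

/-- The range of `κ_{B_S}` (non-zero signs) is spanned by the monomials hit by the active sources. -/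
theorem range_kappa (S : Finset (Fin N)) {ε : Fin N × Fin N → K} (hε : ∀ q ∈ act S, ε q ≠ 0) :
    LinearMap.range (kappa S ε)
      = Submodule.span K (Set.range fun m : ((act S).image (tg S) : Finset (Mono N)) =>
          Pi.single (M := fun _ => K) m.1 (1 : K)) := by
  apply le_antisymm
  · rw [LinearMap.range_eq_map, ← (Pi.basisFun K (Fin N × Fin N)).span_eq, Submodule.map_span,
      Submodule.span_le]
    rintro _ ⟨_, ⟨q, rfl⟩, rfl⟩
    rw [Pi.basisFun_apply, SetLike.mem_coe, kappa_single]
    by_cases hq : q ∈ act S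
    · rw [if_pos hq, single_eq_smul_single_one]
      exact Submodule.smul_mem _ _
        (Submodule.subset_span ⟨⟨tg S q, Finset.mem_image_of_mem _ hq⟩, rfl⟩)
    · rw [if_neg hq]; exact Submodule.zero_mem _
  · rw [Submodule.span_le]
    rintro _ ⟨⟨m, hm⟩, rfl⟩
    obtain ⟨q, hq, rfl⟩ := Finset.mem_image.1 hm
    refine ⟨Pi.single q (ε q)⁻¹, ?_⟩
    rw [kappa_single, if_pos hq, mul_inv_cancel₀ (hε q hq)]

/-- **One sub-torus: `rank κ_{B_S} = (N − |S|)·|S|`** (`= n²` at `|S| = n`, `N = 2n`), whatever the non-zero signs —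
equal to `h¹(N_{B_S})` (`card_blochIndex`): the `κ`-model form of «single torus INJ n²» (`r` onto, `π` injective). -/
theorem finrank_range_kappa (S : Finset (Fin N)) {ε : Fin N × Fin N → K} (hε : ∀ q ∈ act S, ε q ≠ 0) :
    Module.finrank K (LinearMap.range (kappa S ε)) = (N - S.card) * S.card := by
  rw [range_kappa S hε, finrank_span_eq_card]
  · rw [Fintype.card_coe, Finset.card_image_of_injOn (tg_injOn S), card_act]
  · have hli := (Pi.basisFun K (Mono N)).linearIndependent
    have : (fun m : ((act S).image (tg S) : Finset (Mono N)) => Pi.single (M := fun _ => K) m.1 (1 : K))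
        = (Pi.basisFun K (Mono N)) ∘ (fun m : ((act S).image (tg S) : Finset (Mono N)) => m.1) := by
      funext m; simp [Pi.basisFun_apply]
    rw [this]
    exact hli.comp _ Subtype.val_injective

end Kappa

/-! ## Two types through the same source space: the near pair -/

section Pair

variable {N : ℕ} {S S' : Finset (Fin N)} {k k' : Fin N} {ε ε' : Fin N × Fin N → K}

/-- A source active for both types never shares its `S`-monomial with an `S'`-monomial of any `S'`-active source. -/
theorem tg_ne_tg_of_both (hSS' : S ≠ S') {q q' : Fin N × Fin N} (hq : q ∈ act S) (hq2 : q ∈ act S')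
    (hq' : q' ∈ act S') : tg S q ≠ tg S' q' := by
  intro h
  obtain ⟨h1, -, -⟩ := (blochTarget_eq_iff hSS' ⟨q, mem_act.1 hq⟩ ⟨q', mem_act.1 hq'⟩).1 h
  exact (mem_act.1 hq2).1 (h1 ▸ (mem_act.1 hq').2)

/-- Near-pair bookkeeping for the unions and intersections of the two types. -/
theorem near_union_inter (hSS' : S ≠ S') (hk : k ∈ S) (hk' : k' ∈ S') (he : S.erase k = S'.erase k') :
    S ∪ S' = insert k' S ∧ S ∩ S' = S.erase k ∧ S'.card = S.card := by
  obtain ⟨hkk, hk'S, hkS'⟩ := near_aux hSS' hk hk' he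
  have hS' : S' = insert k' (S.erase k) := by rw [he, Finset.insert_erase hk']
  refine ⟨?_, ?_, ?_⟩
  · ext x
    simp only [Finset.mem_union, Finset.mem_insert, hS', Finset.mem_erase]
    constructor
    · rintro (h | rfl | ⟨-, h⟩)
      · exact Or.inr h
      · exact Or.inl rfl
      · exact Or.inr h
    · rintro (rfl | h)
      · exact Or.inr (Or.inl rfl)
      · exact Or.inl h
  · ext x
    simp only [Finset.mem_inter, hS', Finset.mem_insert, Finset.mem_erase]
    constructor
    · rintro ⟨hx, rfl | ⟨hxk, -⟩⟩
      · exact absurd hx hk'S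
      · exact ⟨hxk, hx⟩
    · rintro ⟨hxk, hx⟩
      exact ⟨hx, Or.inr ⟨hxk, hx⟩⟩
  · rw [hS', Finset.card_insert_of_notMem (fun h => hk'S (Finset.mem_of_mem_erase h)),
      Finset.card_erase_of_mem hk]
    have := Finset.card_pos.2 ⟨k, hk⟩
    omega

/-- The doubly active sources: `q.1 ∉ S ∪ S'`, `q.2 ∈ S ∩ S'`; there are `(N − p − 1)(p − 1)` of them. -/
theorem card_act_inter_act (hSS' : S ≠ S') (hk : k ∈ S) (hk' : k' ∈ S') (he : S.erase k = S'.erase k') :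
    (act S ∩ act S').card = (N - S.card - 1) * (S.card - 1) := by
  obtain ⟨-, hk'S, -⟩ := near_aux hSS' hk hk' he
  obtain ⟨hU, hI, -⟩ := near_union_inter hSS' hk hk' he
  have h : act S ∩ act S' = (S ∪ S')ᶜ ×ˢ (S ∩ S') := by
    ext q
    simp only [Finset.mem_inter, mem_act, Finset.mem_product, Finset.mem_compl, Finset.mem_union, not_or]
    tauto
  rw [h, Finset.card_product, Finset.card_compl, Fintype.card_fin, hU, hI,
    Finset.card_insert_of_notMem hk'S, Finset.card_erase_of_mem hk, Nat.sub_sub]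

/-- The singly active sources of the two types share EXACTLY ONE monomial, `dz_{S ∖ k} ∧ dz̄_{S ∪ k'}`
(file III `image_inter_image_eq_singleton`, restricted to the singly active sources, which contain both witnesses). -/
theorem image_sdiff_inter_image_sdiff (hSS' : S ≠ S') (hk : k ∈ S) (hk' : k' ∈ S')
    (he : S.erase k = S'.erase k') :
    (act S \ act S').image (tg S) ∩ (act S' \ act S).image (tg S') = {(S.erase k, insert k' S)} := by
  obtain ⟨hkk, hk'S, hkS'⟩ := near_aux hSS' hk hk' he
  apply Finset.Subset.antisymm
  · intro m hm
    rw [← image_inter_image_eq_singleton hSS' hk hk' he]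
    rw [Finset.mem_inter] at hm ⊢
    obtain ⟨h1, h2⟩ := hm
    obtain ⟨q, hq, rfl⟩ := Finset.mem_image.1 h1
    obtain ⟨q', hq', hqq'⟩ := Finset.mem_image.1 h2
    refine ⟨Finset.mem_image.2 ⟨⟨q, mem_act.1 (Finset.mem_sdiff.1 hq).1⟩, Finset.mem_univ _, rfl⟩,
      Finset.mem_image.2 ⟨⟨q', mem_act.1 (Finset.mem_sdiff.1 hq').1⟩, Finset.mem_univ _, hqq'⟩⟩
  · rw [Finset.singleton_subset_iff, Finset.mem_inter]
    refine ⟨Finset.mem_image.2 ⟨(k', k), ?_, rfl⟩, Finset.mem_image.2 ⟨(k, k'), ?_, ?_⟩⟩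
    · rw [Finset.mem_sdiff, mem_act, mem_act]
      exact ⟨⟨hk'S, hk⟩, fun h => h.1 hk'⟩
    · rw [Finset.mem_sdiff, mem_act, mem_act]
      exact ⟨⟨hkS', hk'⟩, fun h => h.1 hk⟩
    · simp only [tg, Prod.mk.injEq]
      exact ⟨he.symm, by rw [← Finset.insert_erase hk, ← Finset.insert_erase hk', he, Finset.insert_comm]⟩

/-- The doubly active sources hit only PRIVATE monomials: none of them is a monomial of a singly active source. -/
theorem tg_not_mem_of_both (hSS' : S ≠ S') {q : Fin N × Fin N} (hq : q ∈ act S) (hq2 : q ∈ act S') :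
    tg S q ∉ (act S \ act S').image (tg S) ∪ (act S' \ act S).image (tg S')
      ∧ tg S' q ∉ (act S \ act S').image (tg S) ∪ (act S' \ act S).image (tg S') := by
  constructor
  · intro h
    rcases Finset.mem_union.1 h with h | h
    · obtain ⟨q', hq', hqq'⟩ := Finset.mem_image.1 h
      have hq'1 := (Finset.mem_sdiff.1 hq').1
      have : q' = q := tg_injOn S (Finset.mem_coe.2 hq'1) (Finset.mem_coe.2 hq) hqq'
      exact (Finset.mem_sdiff.1 hq').2 (this ▸ hq2)
    · obtain ⟨q', hq', hqq'⟩ := Finset.mem_image.1 h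
      exact tg_ne_tg_of_both hSS' hq hq2 (Finset.mem_sdiff.1 hq').1 hqq'.symm
  · intro h
    rcases Finset.mem_union.1 h with h | h
    · obtain ⟨q', hq', hqq'⟩ := Finset.mem_image.1 h
      exact tg_ne_tg_of_both hSS'.symm hq2 hq (Finset.mem_sdiff.1 hq').1 hqq'.symm
    · obtain ⟨q', hq', hqq'⟩ := Finset.mem_image.1 h
      have hq'1 := (Finset.mem_sdiff.1 hq').1
      have : q' = q := tg_injOn S' (Finset.mem_coe.2 hq'1) (Finset.mem_coe.2 hq2) hqq'
      exact (Finset.mem_sdiff.1 hq').2 (this ▸ hq)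

/-- The candidate basis of `range κ_Z` for a near pair: the unit vectors of the monomials `T` hit by singly active
sources, and the images `ε_q e_{tg S q} + ε'_q e_{tg S' q}` of the doubly active sources `B`. -/
def ncFamily (S S' : Finset (Fin N)) (ε ε' : Fin N × Fin N → K) (T : Finset (Mono N))
    (B : Finset (Fin N × Fin N)) : (T ⊕ B : Type) → (Mono N → K) :=
  Sum.elim (fun m => Pi.single (M := fun _ => K) m.1 1)
    (fun q => Pi.single (M := fun _ => K) (tg S q.1) (ε q.1) + Pi.single (M := fun _ => K) (tg S' q.1) (ε' q.1))

/-- Abstract linear independence of such a family: it suffices that the `B`-sources have PRIVATE first monomials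
(outside `T`, pairwise distinct, distinct from all second monomials) with non-zero coefficient, and second monomials
outside `T`. -/
theorem linearIndependent_ncFamily {T : Finset (Mono N)} {B : Finset (Fin N × Fin N)}
    (h1 : ∀ q ∈ B, tg S q ∉ T) (h2 : ∀ q ∈ B, tg S' q ∉ T) (h3 : Set.InjOn (tg S) (B : Set (Fin N × Fin N)))
    (h4 : ∀ q ∈ B, ∀ q' ∈ B, tg S' q' ≠ tg S q) (hε : ∀ q ∈ B, ε q ≠ 0) :
    LinearIndependent K (ncFamily S S' ε ε' T B) := by
  rw [linearIndependent_iff']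
  intro s g hsum x hx
  have heval : ∀ m : Mono N, ∑ y ∈ s, g y * ncFamily S S' ε ε' T B y m = 0 := by
    intro m
    have := congr_fun hsum m
    simpa only [Finset.sum_apply, Pi.smul_apply, smul_eq_mul, Pi.zero_apply] using this
  rcases x with ⟨m, hm⟩ | ⟨q₀, hq₀⟩
  · -- evaluate at the monomial `m ∈ T`: only the unit vector `e_m` contributes
    have h := heval m
    rw [Finset.sum_eq_single (Sum.inl ⟨m, hm⟩)] at h
    · simpa [ncFamily] using h
    · intro y _ hy
      rcases y with ⟨m', hm'⟩ | ⟨q, hq⟩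
      · have : m ≠ m' := fun h => hy (by subst h; rfl)
        simp [ncFamily, this]
      · have hne1 : m ≠ tg S q := fun h => h1 q hq (h ▸ hm)
        have hne2 : m ≠ tg S' q := fun h => h2 q hq (h ▸ hm)
        simp [ncFamily, hne1, hne2]
    · intro h; exact absurd hx h
  · -- evaluate at the private monomial `tg S q₀`: only the `q₀`-vector contributes, with coefficient `ε q₀`
    have h := heval (tg S q₀)
    rw [Finset.sum_eq_single (Sum.inr ⟨q₀, hq₀⟩)] at h
    · have hne : tg S q₀ ≠ tg S' q₀ := (h4 q₀ hq₀ q₀ hq₀).symm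
      simp only [ncFamily, Sum.elim_inr, Pi.add_apply, Pi.single_eq_same, Pi.single_apply, hne, if_false,
        add_zero, mul_eq_zero] at h
      exact h.resolve_right (hε q₀ hq₀)
    · intro y _ hy
      rcases y with ⟨m', hm'⟩ | ⟨q, hq⟩
      · have : tg S q₀ ≠ m' := fun h => h1 q₀ hq₀ (h ▸ hm')
        simp [ncFamily, this]
      · have hqq : q ≠ q₀ := fun h => hy (by subst h; rfl)
        have hne1 : tg S q₀ ≠ tg S q :=
          fun h => hqq (h3 (Finset.mem_coe.2 hq) (Finset.mem_coe.2 hq₀) h.symm)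
        have hne2 : tg S q₀ ≠ tg S' q := (h4 q₀ hq₀ q hq).symm
        simp [ncFamily, hne1, hne2]
    · intro h; exact absurd hx h

/-- `κ_Z = κ_S + κ_{S'}` on a basis vector. -/
theorem kappa_pair_single (q : Fin N × Fin N) (c : K) :
    (kappa S ε + kappa S' ε') (Pi.single q c)
      = (if q ∈ act S then Pi.single (M := fun _ => K) (tg S q) (ε q * c) else 0)
        + (if q ∈ act S' then Pi.single (M := fun _ => K) (tg S' q) (ε' q * c) else 0) := by
  rw [LinearMap.add_apply, kappa_single, kappa_single]

end Pair

end Summit.Ventures.HSemireg.ObstructionLocus
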